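import Literature.Combinatorics.Optimization.PsdFactorNorms
import HarnessLib

/-!
# FGPRT Remark 6.3: the rank-one blow-up `N` of a psd factorization — PROVED
# (Fawzi–Gouveia–Parrilo–Robinson–Thomas 2015, §6.1)

Source: H. Fawzi, J. Gouveia, P. A. Parrilo, R. Z. Robinson, R. R. Thomas, *Positive semidefinite
rank*, Math. Program. Ser. B 153 (2015) 133–177 = arXiv:1407.4095 [FawziEtAl2015], §6.1 "Rank of
factors", **Remark 6.3** (held text `paper:arxiv-1407.4095`, chunk p18; arXiv numbering), and the
sentence of §6.2 (p19) that uses it. `PsdFactorNorms.lean` (same directory: Propositions 6.1–6.2,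
Theorem 6.5, Corollaries 6.6–6.8) lists Remark 6.3 as "NOT here"; this file supplies it. Vocabulary:
the tree's `HasPsdFactorization M k` ("`rank_psd(M) ≤ k`", Def. 2.2) and `HasHadamardSqrtOfRankLE N k`
("`rank_√(N) ≤ k`", Def. 5.2; `PsdRankComparisons.lean`), Proposition 6.2 (⇒)
`HasHadamardSqrtOfRankLE.exists_rankOne_psdFactorization` and the discharged Corollary 6.7
`FawziEtAl2015_cor67_holds` (`PsdFactorNorms.lean`).

The printed text (p18, verbatim). **Remark 6.3.** "Let `M` be a `p × q` nonnegative matrix with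
`rank_psd(M) = k`. Suppose `A_i`, `i = 1,…,p` and `B_j`, `j = 1,…,q` form a `S^k_+` factorization of
`M`. Each `A_i` can be written as `Σ_{l=1}^k v_{i,l} v_{i,l}ᵀ`, and each `B_j` as
`Σ_{l=1}^k w_{j,l} w_{j,l}ᵀ`. Define `N` as the matrix indexed by `{1,…,p} × {1,…,k}` and
`{1,…,q} × {1,…,k}` whose entry `N_{(i,s),(j,r)}` is given by `(v_{i,s}ᵀ w_{j,r})²`. Then,
`N ∈ ℝ_+^{pk × qk}` consists of `p × q` blocks of size `k × k` and `rank_√(N) = k`. Furthermore,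
summing all the entries of block `(i,j)` of `N` gives us entry `(i,j)` of `M`. This remark allows us
to transfer properties from rank one factorizations to general factorizations, an example can be
seen at the end of the next subsection." And (p19, after Corollary 6.8): "Note that if we are only
interested in getting a bound of `k^{5/4}√‖M‖_∞` (which is already enough for the application in
[briet2013]) we can derive it directly from Corollary 6.7, together with Remark 6.3, illustrating that
properties valid for rank one factors can sometimes be extended to general factorizations."

Contents (all PROVED; one definition, no named facts).
* "Each `A_i` can be written as `Σ_{l=1}^k v_{i,l} v_{i,l}ᵀ`": `exists_eq_sum_vecMulVec_of_posSemidef`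
  (a real psd `k × k` matrix is a sum of `k` terms `v_l v_lᵀ`; `A = CᵀC`, `v_l` = row `l` of `C`).
* The matrix `N`: `rankOneBlowup v w` on `(ι × Fin k) × (κ × Fin k)`, entry `(v_{i,s}ᵀ w_{j,r})²`;
  "`N ∈ ℝ_+^{pk×qk}`" (`rankOneBlowup_nonneg`); "`rank_√(N) ≤ k`" (`hasHadamardSqrtOfRankLE_rankOneBlowup`:
  the Hadamard square root `(v_{i,s}ᵀ w_{j,r})` factors through `ℝ^k`); "summing all the entries of
  block `(i,j)` of `N` gives us entry `(i,j)` of `M`" (`sum_rankOneBlowup_block`); packaged as printed in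
  `FawziEtAl2015_rem63`.
* The transfer mechanism behind "`rank_√(N) = k`": block sums of a psd factorization form a psd
  factorization of the same size (`HasPsdFactorization.blockSum`), so ANY matrix `N` whose `(i,j)` block
  sums are `M_{ij}` satisfies `rank_√(N) ≤ k' ⇒ rank_psd(M) ≤ k'` (`hasPsdFactorization_of_blockSum_eq`,
  through Proposition 6.2 ⇒); hence when `rank_psd(M) = k` (no psd factorization of size `< k`) the
  blow-up has `rank_√(N) = k` exactly (`FawziEtAl2015_rem63_sqrtRank`).
* The p19 illustration, in the form the transfer actually yields (`FawziEtAl2015_rem63_traceBound`):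
  from ANY size-`k` psd factorization of `M` with `M_{ij} ≤ Δ`, Corollary 6.7 applied to the
  Hadamard square root of `N` (entries `|v_{i,s}ᵀ w_{j,r}| ≤ √Δ`, rank `k' ≤ k`) and re-summation of
  the rank-one terms give a psd factorization of size `k'` whose factors have TRACE (hence largest
  eigenvalue) at most `k·√k'·√Δ ≤ k^{3/2}√Δ`. SCOPE NOTE: the printed parenthetical exponent `5/4` is
  not reproduced by this direct count (`k` rank-one terms, each of squared norm `≤ k'^{1/2}√Δ`); we
  record exactly what the count gives and do not type the `k^{5/4}` sentence as a statement.
-/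

noncomputable section

open Matrix Finset
open scoped MatrixOrder

namespace Literature.Combinatorics.Optimization

variable {ι κ : Type*}

/-! ### Rank-one decompositions of the factors -/

/-- "Each `A_i` can be written as `Σ_{l=1}^k v_{i,l} v_{i,l}ᵀ`" (p18): a real psd `k × k` matrix is a
sum of `k` rank-one psd terms — write `A = CᵀC` and take `v_l` to be the `l`-th row of `C`.
[cite: FawziEtAl2015, Remark 6.3 (p18)] -/
theorem exists_eq_sum_vecMulVec_of_posSemidef {k : ℕ} {A : Matrix (Fin k) (Fin k) ℝ}
    (hA : A.PosSemidef) : ∃ v : Fin k → (Fin k → ℝ), A = ∑ l, vecMulVec (v l) (v l) := by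
  obtain ⟨C, hC⟩ := CStarAlgebra.nonneg_iff_eq_star_mul_self.mp hA.nonneg
  have hCT : star C = Cᵀ := by
    rw [star_eq_conjTranspose, conjTranspose_eq_transpose_of_trivial]
  refine ⟨fun l => C l, ?_⟩
  ext s t
  rw [hC, hCT, Matrix.mul_apply, Matrix.sum_apply]
  exact sum_congr rfl fun l _ => by simp [vecMulVec_apply]

/-- Positive semidefiniteness is preserved by finite sums. [folklore] -/
private theorem posSemidef_finset_sum {σ : Type*} {k : ℕ} (s : Finset σ)
    (f : σ → Matrix (Fin k) (Fin k) ℝ) (hf : ∀ x ∈ s, (f x).PosSemidef) :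
    (∑ x ∈ s, f x).PosSemidef :=
  Finset.sum_induction f (fun X => X.PosSemidef) (fun _ _ ha hb => ha.add hb) PosSemidef.zero hf

/-! ### The blow-up matrix `N` of Remark 6.3 -/

/-- **FGPRT Remark 6.3's matrix `N`** (p18, verbatim): "Define `N` as the matrix indexed by
`{1,…,p} × {1,…,k}` and `{1,…,q} × {1,…,k}` whose entry `N_{(i,s),(j,r)}` is given by
`(v_{i,s}ᵀ w_{j,r})²`", for families of vectors `v_{i,s}, w_{j,r} ∈ ℝ^k`.
[cite: FawziEtAl2015, Remark 6.3 (p18)] -/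
def rankOneBlowup {k : ℕ} (v : ι → Fin k → (Fin k → ℝ)) (w : κ → Fin k → (Fin k → ℝ)) :
    Matrix (ι × Fin k) (κ × Fin k) ℝ :=
  Matrix.of fun a b => (v a.1 a.2 ⬝ᵥ w b.1 b.2) ^ 2

/-- Entries of `N`. [cite: FawziEtAl2015, Remark 6.3 (p18)] -/
theorem rankOneBlowup_apply {k : ℕ} (v : ι → Fin k → (Fin k → ℝ)) (w : κ → Fin k → (Fin k → ℝ))
    (i : ι) (s : Fin k) (j : κ) (r : Fin k) :
    rankOneBlowup v w (i, s) (j, r) = (v i s ⬝ᵥ w j r) ^ 2 := rfl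

/-- "`N ∈ ℝ_+^{pk × qk}`" (p18): the entries of `N` are squares. [cite: FawziEtAl2015, Remark 6.3 (p18)] -/
theorem rankOneBlowup_nonneg {k : ℕ} (v : ι → Fin k → (Fin k → ℝ)) (w : κ → Fin k → (Fin k → ℝ))
    (a : ι × Fin k) (b : κ × Fin k) : 0 ≤ rankOneBlowup v w a b :=
  sq_nonneg _

/-- "`rank_√(N) ≤ k`" (half of the printed "`rank_√(N) = k`", p18): the matrix `(v_{i,s}ᵀ w_{j,r})` is
a Hadamard square root of `N` and factors as `V W` through `ℝ^k` (`V` has the `v_{i,s}` as rows, `W`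
the `w_{j,r}` as columns), so its rank is at most `k`. [cite: FawziEtAl2015, Remark 6.3 (p18)] -/
theorem hasHadamardSqrtOfRankLE_rankOneBlowup [Fintype ι] [Fintype κ] {k : ℕ}
    (v : ι → Fin k → (Fin k → ℝ)) (w : κ → Fin k → (Fin k → ℝ)) :
    HasHadamardSqrtOfRankLE (rankOneBlowup v w) k := by
  classical
  let V : Matrix (ι × Fin k) (Fin k) ℝ := Matrix.of fun a l => v a.1 a.2 l
  let W : Matrix (Fin k) (κ × Fin k) ℝ := Matrix.of fun l b => w b.1 b.2 l
  refine ⟨V * W, fun a b => ?_, ?_⟩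
  · simp only [rankOneBlowup, Matrix.of_apply, Matrix.mul_apply, V, W, dotProduct]
  · calc (V * W).rank ≤ V.rank := rank_mul_le_left V W
      _ ≤ Fintype.card (Fin k) := rank_le_card_width V
      _ = k := Fintype.card_fin k

/-- "summing all the entries of block `(i,j)` of `N` gives us entry `(i,j)` of `M`" (p18):
`Σ_{s,r} (v_{i,s}ᵀ w_{j,r})² = ⟨Σ_s v_{i,s}v_{i,s}ᵀ, Σ_r w_{j,r}w_{j,r}ᵀ⟩ = ⟨A_i, B_j⟩`.
[cite: FawziEtAl2015, Remark 6.3 (p18)] -/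
theorem sum_rankOneBlowup_block {k : ℕ} (v : ι → Fin k → (Fin k → ℝ))
    (w : κ → Fin k → (Fin k → ℝ)) (i : ι) (j : κ) :
    ∑ s, ∑ r, rankOneBlowup v w (i, s) (j, r) =
      ((∑ s, vecMulVec (v i s) (v i s)) * ∑ r, vecMulVec (w j r) (w j r)).trace := by
  rw [Finset.sum_mul, trace_sum]
  refine sum_congr rfl fun s _ => ?_
  rw [Finset.mul_sum, trace_sum]
  refine sum_congr rfl fun r _ => ?_
  rw [vecMulVec_mul_vecMulVec, trace_vecMulVec, dotProduct_smul, smul_eq_mul, rankOneBlowup_apply, sq]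

/-- **FGPRT Remark 6.3** (p18), the construction as printed: every `S^k_+` factorization
`M_{ij} = ⟨A_i, B_j⟩` admits rank-one decompositions `A_i = Σ_{l=1}^k v_{i,l}v_{i,l}ᵀ`,
`B_j = Σ_{l=1}^k w_{j,l}w_{j,l}ᵀ`, and the `pk × qk` matrix `N_{(i,s),(j,r)} = (v_{i,s}ᵀ w_{j,r})²` is
entrywise nonnegative, has `rank_√(N) ≤ k`, and "summing all the entries of block `(i,j)` of `N` gives
us entry `(i,j)` of `M`". (The printed equality `rank_√(N) = k` under `rank_psd(M) = k` is
`FawziEtAl2015_rem63_sqrtRank`.) [cite: FawziEtAl2015, Remark 6.3 (p18)] -/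
theorem FawziEtAl2015_rem63 [Fintype ι] [Fintype κ] {k : ℕ} {M : Matrix ι κ ℝ}
    {A : ι → Matrix (Fin k) (Fin k) ℝ} {B : κ → Matrix (Fin k) (Fin k) ℝ}
    (hA : ∀ i, (A i).PosSemidef) (hB : ∀ j, (B j).PosSemidef)
    (hM : ∀ i j, M i j = (A i * B j).trace) :
    ∃ (v : ι → Fin k → (Fin k → ℝ)) (w : κ → Fin k → (Fin k → ℝ)),
      (∀ i, A i = ∑ s, vecMulVec (v i s) (v i s)) ∧ (∀ j, B j = ∑ r, vecMulVec (w j r) (w j r)) ∧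
      (∀ a b, 0 ≤ rankOneBlowup v w a b) ∧ HasHadamardSqrtOfRankLE (rankOneBlowup v w) k ∧
      ∀ i j, ∑ s, ∑ r, rankOneBlowup v w (i, s) (j, r) = M i j := by
  choose v hv using fun i => exists_eq_sum_vecMulVec_of_posSemidef (hA i)
  choose w hw using fun j => exists_eq_sum_vecMulVec_of_posSemidef (hB j)
  refine ⟨v, w, hv, hw, rankOneBlowup_nonneg v w, hasHadamardSqrtOfRankLE_rankOneBlowup v w,
    fun i j => ?_⟩
  rw [sum_rankOneBlowup_block, ← hv i, ← hw j, hM i j]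

/-! ### The transfer mechanism: block sums of psd factorizations -/

/-- **Block sums of a psd factorization** (the mechanism of Remark 6.3's "transfer"): if a matrix `N`
indexed by `(ι × σ) × (κ × τ)` has a psd factorization of size `k`, then so does the matrix of its block
sums `(i,j) ↦ Σ_{s,r} N_{(i,s),(j,r)}` — take `A'_i = Σ_s A_{(i,s)}`, `B'_j = Σ_r B_{(j,r)}`.
[cite: FawziEtAl2015, Remark 6.3 (p18)] -/
theorem HasPsdFactorization.blockSum {σ τ : Type*} [Fintype σ] [Fintype τ] {k : ℕ}
    {N : (ι × σ) → (κ × τ) → ℝ} (h : HasPsdFactorization N k) :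
    HasPsdFactorization (fun i j => ∑ s, ∑ r, N (i, s) (j, r)) k := by
  obtain ⟨A, B, hA, hB, hN⟩ := h
  refine ⟨fun i => ∑ s, A (i, s), fun j => ∑ r, B (j, r),
    fun i => posSemidef_finset_sum _ _ fun s _ => hA (i, s),
    fun j => posSemidef_finset_sum _ _ fun r _ => hB (j, r), fun i j => ?_⟩
  rw [Finset.sum_mul, trace_sum]
  refine sum_congr rfl fun s _ => ?_
  rw [Finset.mul_sum, trace_sum]
  exact sum_congr rfl fun r _ => hN (i, s) (j, r)

/-- **`rank_√(N) ≤ k' ⇒ rank_psd(M) ≤ k'`** for ANY matrix `N` whose block sums are the entries of `M`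
(p18: the reason `rank_√(N)` cannot drop below `rank_psd(M)`): a Hadamard square root of `N` of rank
`≤ k'` gives, by Proposition 6.2 (⇒), a size-`k'` psd factorization of `N` by rank-one factors, whose
block sums form a size-`k'` psd factorization of `M`. [cite: FawziEtAl2015, Remark 6.3 (p18) with
Prop. 6.2 (p18)] -/
theorem hasPsdFactorization_of_blockSum_eq [Fintype ι] [Fintype κ] {σ τ : Type*} [Fintype σ]
    [Fintype τ] {k' : ℕ} {N : Matrix (ι × σ) (κ × τ) ℝ} {M : Matrix ι κ ℝ}
    (hNM : ∀ i j, ∑ s, ∑ r, N (i, s) (j, r) = M i j) (hN : HasHadamardSqrtOfRankLE N k') :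
    HasPsdFactorization M k' := by
  obtain ⟨A, B, hA, hB, hN'⟩ := hN.exists_rankOne_psdFactorization
  have h : HasPsdFactorization (fun a b => N a b) k' :=
    ⟨A, B, fun a => (hA a).1, fun b => (hB b).1, hN'⟩
  have hMeq : (fun i j => M i j) = fun i j => ∑ s, ∑ r, N (i, s) (j, r) :=
    funext fun i => funext fun j => (hNM i j).symm
  have h' := h.blockSum
  rw [← hMeq] at h'
  exact h'

/-- **FGPRT Remark 6.3, "`rank_√(N) = k`"** (p18): if `rank_psd(M) = k` in the sense that `M` has no
psd factorization of size `< k`, then the blow-up `N` of any size-`k` factorization (indeed any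
`N = rankOneBlowup v w` whose block sums are the `M_{ij}`) has square root rank exactly `k`:
`rank_√(N) ≤ k`, and `rank_√(N) ≤ k'` fails for every `k' < k`. [cite: FawziEtAl2015, Remark 6.3 (p18)] -/
theorem FawziEtAl2015_rem63_sqrtRank [Fintype ι] [Fintype κ] {k : ℕ} {M : Matrix ι κ ℝ}
    (hmin : ∀ k' < k, ¬ HasPsdFactorization M k') {v : ι → Fin k → (Fin k → ℝ)}
    {w : κ → Fin k → (Fin k → ℝ)} (hNM : ∀ i j, ∑ s, ∑ r, rankOneBlowup v w (i, s) (j, r) = M i j) :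
    HasHadamardSqrtOfRankLE (rankOneBlowup v w) k ∧
      ∀ k' < k, ¬ HasHadamardSqrtOfRankLE (rankOneBlowup v w) k' :=
  ⟨hasHadamardSqrtOfRankLE_rankOneBlowup v w,
    fun k' hk' hN => hmin k' hk' (hasPsdFactorization_of_blockSum_eq hNM hN)⟩

/-- **Remark 6.3 packaged with "`rank_psd(M) = k`"** (p18): for `M` with a size-`k` psd factorization
and none of smaller size, there are vectors `v_{i,s}, w_{j,r} ∈ ℝ^k` whose blow-up `N` is nonnegative,
has `(i,j)` block sums `M_{ij}`, and has square root rank exactly `k`.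
[cite: FawziEtAl2015, Remark 6.3 (p18)] -/
theorem FawziEtAl2015_rem63_of_psdRank_eq [Fintype ι] [Fintype κ] {k : ℕ} {M : Matrix ι κ ℝ}
    (hk : HasPsdFactorization M k) (hmin : ∀ k' < k, ¬ HasPsdFactorization M k') :
    ∃ (v : ι → Fin k → (Fin k → ℝ)) (w : κ → Fin k → (Fin k → ℝ)),
      (∀ a b, 0 ≤ rankOneBlowup v w a b) ∧
      (∀ i j, ∑ s, ∑ r, rankOneBlowup v w (i, s) (j, r) = M i j) ∧
      HasHadamardSqrtOfRankLE (rankOneBlowup v w) k ∧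
      ∀ k' < k, ¬ HasHadamardSqrtOfRankLE (rankOneBlowup v w) k' := by
  obtain ⟨A, B, hA, hB, hM⟩ := hk
  obtain ⟨v, w, -, -, hnn, -, hsum⟩ := FawziEtAl2015_rem63 hA hB hM
  exact ⟨v, w, hnn, hsum, FawziEtAl2015_rem63_sqrtRank hmin hsum⟩

/-! ### The p19 illustration: a norm bound transferred from Corollary 6.7 -/

/-- The trace of `Σ_s a_s a_sᵀ` is `Σ_s ‖a_s‖²`. [folklore] -/
private theorem trace_sum_vecMulVec {k m : ℕ} (a : Fin m → (Fin k → ℝ)) :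
    (∑ s, vecMulVec (a s) (a s)).trace = ∑ s, ∑ l, a s l ^ 2 := by
  rw [trace_sum]
  exact sum_congr rfl fun s _ => by
    rw [trace_vecMulVec, dotProduct]
    exact sum_congr rfl fun l _ => by ring

/-- `(k'^{1/4})² = √k'`. [folklore] -/
private theorem rpow_quarter_sq (x : ℝ) (hx : 0 ≤ x) :
    (x ^ ((1 : ℝ) / 4)) ^ 2 = Real.sqrt x := by
  rw [← Real.rpow_natCast, ← Real.rpow_mul hx, Real.sqrt_eq_rpow]
  norm_num

/-- **The p19 transfer, as the count gives it** ("we can derive it directly from Corollary 6.7,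
together with Remark 6.3, illustrating that properties valid for rank one factors can sometimes be
extended to general factorizations"): if `M_{ij} ≤ Δ` and `M` has a psd factorization of size `k`,
then — blowing it up to `N` (Remark 6.3), taking the Hadamard square root `N'` of `N` of rank `k' ≤ k`
(`|N'| ≤ √Δ` entrywise since `N'² = N ≤ M ≤ Δ` blockwise), rescaling a rank factorization of `N'` by
Corollary 6.7 (columns of norm `≤ k'^{1/4}Δ^{1/4}`), and re-summing the `k` rank-one terms of each
block — `M` has a psd factorization of size `k'` all of whose factors have trace (hence every
eigenvalue) at most `k·√k'·√Δ ≤ k^{3/2}√Δ`. The printed sentence asserts the exponent `5/4`; this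
statement records the exponent the direct count yields and does not claim `5/4`.
[cite: FawziEtAl2015, Remark 6.3 (p18) and §6.2 after Cor. 6.8 (p19); Cor. 6.7 (p19)] -/
theorem FawziEtAl2015_rem63_traceBound {ι κ : Type} [Fintype ι] [Fintype κ] {k : ℕ}
    {M : Matrix ι κ ℝ} {Δ : ℝ} (hMΔ : ∀ i j, M i j ≤ Δ)
    (hk : HasPsdFactorization M k) :
    ∃ k' ≤ k, ∃ (A : ι → Matrix (Fin k') (Fin k') ℝ) (B : κ → Matrix (Fin k') (Fin k') ℝ),
      (∀ i, (A i).PosSemidef) ∧ (∀ j, (B j).PosSemidef) ∧ (∀ i j, M i j = (A i * B j).trace) ∧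
      (∀ i, (A i).trace ≤ k * (Real.sqrt k' * Real.sqrt Δ)) ∧
      ∀ j, (B j).trace ≤ k * (Real.sqrt k' * Real.sqrt Δ) := by
  classical
  obtain ⟨A, B, hA, hB, hM⟩ := hk
  obtain ⟨v, w, -, -, -, -, hsum⟩ := FawziEtAl2015_rem63 hA hB hM
  -- the Hadamard square root `N'` of `N`, its rank `k' ≤ k`, and its entry bound `√Δ`
  let N' : Matrix (ι × Fin k) (κ × Fin k) ℝ := Matrix.of fun a b => v a.1 a.2 ⬝ᵥ w b.1 b.2
  have hN'rank : N'.rank ≤ k := by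
    let V : Matrix (ι × Fin k) (Fin k) ℝ := Matrix.of fun a l => v a.1 a.2 l
    let W : Matrix (Fin k) (κ × Fin k) ℝ := Matrix.of fun l b => w b.1 b.2 l
    have hVW : N' = V * W := by
      ext a b
      simp only [N', V, W, Matrix.of_apply, Matrix.mul_apply, dotProduct]
    rw [hVW]
    calc (V * W).rank ≤ V.rank := rank_mul_le_left V W
      _ ≤ Fintype.card (Fin k) := rank_le_card_width V
      _ = k := Fintype.card_fin k
  have hentry : ∀ a b, |N' a b| ≤ Real.sqrt Δ := fun a b => by
    obtain ⟨i, s⟩ := a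
    obtain ⟨j, r⟩ := b
    refine Real.abs_le_sqrt ?_
    calc (N' (i, s) (j, r)) ^ 2 = rankOneBlowup v w (i, s) (j, r) := rfl
      _ ≤ ∑ r', rankOneBlowup v w (i, s) (j, r') :=
          Finset.single_le_sum (fun r' _ => rankOneBlowup_nonneg v w _ _) (mem_univ r)
      _ ≤ ∑ s', ∑ r', rankOneBlowup v w (i, s') (j, r') :=
          Finset.single_le_sum (f := fun s' => ∑ r', rankOneBlowup v w (i, s') (j, r'))
            (fun s' _ => sum_nonneg fun r' _ => rankOneBlowup_nonneg v w _ _) (mem_univ s)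
      _ = M i j := hsum i j
      _ ≤ Δ := hMΔ i j
  -- Corollary 6.7 applied to `N'`
  set k' := N'.rank with hk'
  obtain ⟨a, b, hab, ha, hb⟩ :=
    FawziEtAl2015_cor67_holds (ι × Fin k) (κ × Fin k) N' k' (Real.sqrt Δ) hk'.symm hentry
  -- the squared-norm bound `‖a‖² ≤ √k' · √Δ`
  have hc2 : ((k' : ℝ) ^ ((1 : ℝ) / 4) * Real.sqrt (Real.sqrt Δ)) ^ 2 = Real.sqrt k' * Real.sqrt Δ := by
    rw [mul_pow, rpow_quarter_sq _ (Nat.cast_nonneg _), Real.sq_sqrt (Real.sqrt_nonneg _)]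
  have hnorm : ∀ {x : Fin k' → ℝ},
      Real.sqrt (∑ l, x l ^ 2) ≤ (k' : ℝ) ^ ((1 : ℝ) / 4) * Real.sqrt (Real.sqrt Δ) →
      ∑ l, x l ^ 2 ≤ Real.sqrt k' * Real.sqrt Δ := fun {x} hx => by
    have h0 : 0 ≤ ∑ l, x l ^ 2 := sum_nonneg fun l _ => sq_nonneg _
    calc ∑ l, x l ^ 2 = (Real.sqrt (∑ l, x l ^ 2)) ^ 2 := (Real.sq_sqrt h0).symm
      _ ≤ ((k' : ℝ) ^ ((1 : ℝ) / 4) * Real.sqrt (Real.sqrt Δ)) ^ 2 :=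
          pow_le_pow_left₀ (Real.sqrt_nonneg _) hx 2
      _ = Real.sqrt k' * Real.sqrt Δ := hc2
  -- re-summed factors
  refine ⟨k', hN'rank, fun i => ∑ s, vecMulVec (a (i, s)) (a (i, s)),
    fun j => ∑ r, vecMulVec (b (j, r)) (b (j, r)),
    fun i => posSemidef_finset_sum _ _ fun s _ => by
      simpa using posSemidef_vecMulVec_self_star (a (i, s)),
    fun j => posSemidef_finset_sum _ _ fun r _ => by
      simpa using posSemidef_vecMulVec_self_star (b (j, r)),
    fun i j => ?_, fun i => ?_, fun j => ?_⟩
  · -- `⟨A'_i, B'_j⟩ = Σ_{s,r} (a_{(i,s)}·b_{(j,r)})² = Σ_{s,r} N'² = Σ block of N = M_{ij}`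
    rw [← hsum i j, Finset.sum_mul, trace_sum]
    refine sum_congr rfl fun s _ => ?_
    rw [Finset.mul_sum, trace_sum]
    refine sum_congr rfl fun r _ => ?_
    rw [vecMulVec_mul_vecMulVec, trace_vecMulVec, dotProduct_smul, smul_eq_mul, rankOneBlowup_apply,
      ← sq]
    have h : N' (i, s) (j, r) = a (i, s) ⬝ᵥ b (j, r) := hab (i, s) (j, r)
    simp only [N', Matrix.of_apply] at h
    rw [h]
  · rw [trace_sum_vecMulVec]
    calc ∑ s, ∑ l, a (i, s) l ^ 2 ≤ ∑ _s : Fin k, Real.sqrt k' * Real.sqrt Δ :=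
          sum_le_sum fun s _ => hnorm (ha (i, s))
      _ = k * (Real.sqrt k' * Real.sqrt Δ) := by
          rw [sum_const, card_univ, Fintype.card_fin, nsmul_eq_mul]
  · rw [trace_sum_vecMulVec]
    calc ∑ r, ∑ l, b (j, r) l ^ 2 ≤ ∑ _r : Fin k, Real.sqrt k' * Real.sqrt Δ :=
          sum_le_sum fun r _ => hnorm (hb (j, r))
      _ = k * (Real.sqrt k' * Real.sqrt Δ) := by
          rw [sum_const, card_univ, Fintype.card_fin, nsmul_eq_mul]

end Literature.Combinatorics.Optimization
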